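import Summits.FinalStateConjecture.FinalStateConjecture.Theorems.DrainImpliesDisperse.Negative.DrainImpliesDisperseFalseOfRoughFramedAxisPulses
import HarnessLib

/-!
# Crux `DrainImpliesDisperse` (stmt-FinalStateConjecture-17283), negative side: the frame time of a global
# near-Minkowski frame is a TIME FUNCTION — the floor clause reduced to the data hypersurface

The framed construction hypotheses (`FramedPulsedObserverDevelopmentExists` p162401,
`FramedAxisPulsesDevelopmentExists` p162717, `RoughFramedAxisPulsesDevelopmentExists` p162967) carry the floor
clause "(F) the frame time `(Ξ a)⁰` is `≥ 0` on `J⁺(ι X)`". For a pinched future-oriented global frame the frame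
time `T = (Ξ ·)⁰` is a TIME FUNCTION — strictly increasing along every future causal curve
(`frame_time_strictMono`: a future causal `X ≠ 0` has frame coordinate `V = dΞ X ≠ 0` with `(Θ^*g)(V,V) ≤ 0` and
`(Θ^*g)(V, ∂₀) < 0`, whence `V⁰ > 0` by `apply_zero_pos_of_norm_sub_bilin_lt_of_le`) — so (F) follows from the
floor ON THE DATA alone, `(Ξ (ι p))⁰ ≥ 0` (`frame_time_nonneg_of_mem_causalFuture`). The resulting hypothesis
`RoughFramedAxisPulsesDataDevelopmentExists` (floor on `ι X` only) implies `RoughFramedAxisPulsesDevelopmentExists`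
and hence `¬ stub_radiativeEnd_rough` and `¬ DrainImpliesDisperse`. Line lead
`prover-line-stmt-FinalStateConjecture-17283-c5-0`, 2026-08-17.
-/

noncomputable section

set_option linter.dupNamespace false -- D-0017: `Summit.<S>.<S>.…` by design

open Set Filter Function TopologicalSpace Topology
open scoped Manifold ContDiff Topology

namespace Summit.FinalStateConjecture.FinalStateConjecture.Theorems.DrainImpliesDisperse.Negative

open Literature.Geometry.Lorentzian
open Summit.FinalStateConjecture (HasCompleteNullInfinity)
open Summit.FinalStateConjecture.FinalStateConjecture.Theses.BondiDrainDispersal (DrainImpliesDisperse)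

/-! ### Algebra: the sign of the time component of a future CAUSAL vector in a pinched frame -/

/-- **Sign of the time component of a future causal vector in a pinched frame** (causal version of
`SlabAchronal.apply_zero_pos_of_norm_sub_bilin_lt`): if `‖G − η‖ < 1/4`, `v ≠ 0`, `G(v, v) ≤ 0` and
`G(v, ∂₀) < 0`, then `v⁰ > 0`. O'Neill 1983, Ch. 5, Lemma 5.26 (perturbative form).
[cite: ONeillSemiRiemannian1983, Ch. 5, Lemma 5.26] -/
theorem apply_zero_pos_of_norm_sub_bilin_lt_of_le {G : E4 →L[ℝ] E4 →L[ℝ] ℝ}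
    (hG : ‖G - Minkowski.bilin‖ < 1 / 4) {v : E4} (hv : v ≠ 0) (htl : G v v ≤ 0)
    (hor : G v (E4.basisVector 0) < 0) : 0 < v 0 := by
  set h : E4 →L[ℝ] E4 →L[ℝ] ℝ := G - Minkowski.bilin with hh
  have hGv : ∀ w : E4, G v w = Minkowski.bilin v w + h v w := fun w ↦ by
    rw [hh]
    show G v w = Minkowski.bilin v w + (G v w - Minkowski.bilin v w)
    ring
  set S : ℝ := ∑ i : Fin 3, v i.succ * v i.succ with hSdef
  have hS0 : 0 ≤ S := Finset.sum_nonneg fun i _ ↦ mul_self_nonneg _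
  have hηvv : Minkowski.bilin v v = -(v 0 * v 0) + S := by rw [Minkowski.bilin_apply]
  have hnorm : ‖v‖ * ‖v‖ = v 0 * v 0 + S := by
    rw [← pow_two, EuclideanSpace.real_norm_sq_eq, Fin.sum_univ_succ, hSdef]
    simp [pow_two]
  have hηve : Minkowski.bilin v (E4.basisVector 0) = -(v 0) := by
    simp [Fin.succ_ne_zero]
  have hne : ‖(E4.basisVector 0 : E4)‖ = 1 := by simp [E4.basisVector]
  have hvv := h.le_opNorm₂ v v
  have hve := h.le_opNorm₂ v (E4.basisVector 0)
  rw [Real.norm_eq_abs] at hvv hve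
  rw [hne, mul_one] at hve
  have hn0 : 0 < ‖v‖ := norm_pos_iff.2 hv
  have hh0 : 0 ≤ ‖h‖ := norm_nonneg h
  have hb1 : |h v v| ≤ 1 / 4 * ‖v‖ * ‖v‖ := hvv.trans (by gcongr)
  have hb2 : |h v (E4.basisVector 0)| ≤ 1 / 4 * ‖v‖ := hve.trans (by gcongr)
  rw [hGv, hηvv] at htl
  rw [hGv, hηve] at hor
  by_contra hle
  push Not at hle
  have h1 : -(1 / 4 * ‖v‖ * ‖v‖) ≤ h v v := (abs_le.mp hb1).1
  have h2 : -(1 / 4 * ‖v‖) ≤ h v (E4.basisVector 0) := (abs_le.mp hb2).1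
  have h3 : 3 / 4 * (‖v‖ * ‖v‖) ≤ 2 * (v 0 * v 0) := by linarith
  have h4 : -(1 / 4 * ‖v‖) < v 0 := by linarith
  nlinarith [mul_pos hn0 hn0, mul_le_mul_of_nonneg_left hle hn0.le]

/-! ### The frame time is a time function -/

section Frame

variable (𝓢 : Spacetime 4)
  (Θ : Minkowski.background.domain → 𝓢.carrier) (Ξ : 𝓢.carrier → E4)
  (hΘ : ContMDiff 𝓘(ℝ, E4) (𝓡 4) ∞ Θ) (hΞ : ContMDiff (𝓡 4) 𝓘(ℝ, E4) ∞ Ξ)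
  (hΘΞ : ∀ p, Θ ⟨Ξ p, Opens.mem_top _⟩ = p)
  (hpinΘ : ∀ x, ‖𝓢.deviation Minkowski.background Θ x‖ < 1 / 4)
  (hfutΘ : ∀ x, 𝓢.timeOrientation.IsFutureDirected
    (mfderiv 𝓘(ℝ, E4) (𝓡 4) Θ x (E4.basisVector 0)))

include hΘ hΞ hΘΞ hpinΘ hfutΘ in
/-- **A future causal vector has positive frame time component**: `(dΞ X)⁰ > 0` for every
future-directed causal `X` (the frame coordinate `V = dΞ X` is non-zero by the frame identity, `(Θ^*g)(V,V) ≤ 0`,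
and `(Θ^*g)(V, ∂₀) = g(X, Θ_*∂₀) < 0` by the timecone lemma). [cite: ONeillSemiRiemannian1983, Ch. 5, Lemma 5.29] -/
theorem frame_time_mfderiv_pos (p : 𝓢.carrier) (X : TangentSpace (𝓡 4) p)
    (hX : 𝓢.timeOrientation.IsFutureDirected X) :
    0 < E4.time (mfderiv (𝓡 4) 𝓘(ℝ, E4) Ξ p X) := by
  set x : Minkowski.background.domain := ⟨Ξ p, Opens.mem_top _⟩ with hx
  set V : E4 := mfderiv (𝓡 4) 𝓘(ℝ, E4) Ξ p X with hV
  set G : E4 →L[ℝ] E4 →L[ℝ] ℝ := 𝓢.deviation Minkowski.background Θ x + Minkowski.bilin with hG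
  have hGn : ‖G - Minkowski.bilin‖ < 1 / 4 := by
    have heq : G - Minkowski.bilin = 𝓢.deviation Minkowski.background Θ x := by
      rw [hG]; exact add_sub_cancel_right (𝓢.deviation Minkowski.background Θ x) Minkowski.bilin
    rw [heq]; exact hpinΘ x
  have hGapp : ∀ u u' : E4, G u u' = 𝓢.metric.val (Θ x) (mfderiv 𝓘(ℝ, E4) (𝓡 4) Θ x u)
      (mfderiv 𝓘(ℝ, E4) (𝓡 4) Θ x u') := by
    intro u u'
    show 𝓢.deviation Minkowski.background Θ x u u' + Minkowski.bilin u u' = _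
    rw [Spacetime.deviation_apply]
    exact sub_add_cancel _ _
  have hframe : mfderiv 𝓘(ℝ, E4) (𝓡 4) Θ x V = X :=
    FramedProper.mfderiv_frame_apply 𝓢 Θ Ξ hΘ hΞ hΘΞ p X
  have hV0 : V ≠ 0 := by
    intro h0
    have : X = 0 := by
      rw [← hframe, h0]
      exact (mfderiv 𝓘(ℝ, E4) (𝓡 4) Θ x).map_zero
    exact hX.1.2 this
  have hgen : ∀ (q : 𝓢.carrier) (Y : TangentSpace (𝓡 4) q), q = Θ x →
      Y = mfderiv 𝓘(ℝ, E4) (𝓡 4) Θ x V → 𝓢.timeOrientation.IsFutureDirected Y →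
      G V V ≤ 0 ∧ G V (E4.basisVector 0) < 0 := by
    rintro q Y rfl hY hYf
    subst hY
    have he1 : 𝓢.metric.IsTimelike (mfderiv 𝓘(ℝ, E4) (𝓡 4) Θ x (E4.basisVector 0)) := by
      show 𝓢.metric.val (Θ x) _ _ < 0
      rw [← hGapp]
      exact Minkowski.apply_basisVector_zero_neg_of_norm_sub_bilin_lt_one (hGn.trans (by norm_num))
    have hor : 𝓢.metric.val (Θ x) (mfderiv 𝓘(ℝ, E4) (𝓡 4) Θ x (E4.basisVector 0))
        (mfderiv 𝓘(ℝ, E4) (𝓡 4) Θ x V) < 0 :=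
      (TimeOrientation.isFutureDirected_iff_val_neg 𝓢.timeOrientation (hfutΘ x) he1 hYf.1).1 hYf
    rw [𝓢.metric.symm] at hor
    rw [← hGapp] at hor
    refine ⟨?_, hor⟩
    rw [hGapp]; exact hYf.1.1
  obtain ⟨h1, h2⟩ := hgen p X (hΘΞ p).symm hframe.symm hX
  exact apply_zero_pos_of_norm_sub_bilin_lt_of_le hGn hV0 h1 h2

include hΘ hΞ hΘΞ hpinΘ hfutΘ in
/-- **The frame time is strictly increasing along future causal curves.** For a future causal curve
`γ` on `[a, b]`, `a < b`: `(Ξ (γ a))⁰ < (Ξ (γ b))⁰` (the derivative of `(Ξ ∘ γ)⁰` is `(dΞ γ')⁰ > 0`;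
`strictMonoOn_of_deriv_pos`). O'Neill 1983, Ch. 14, p. 402. [cite: ONeillSemiRiemannian1983, Ch. 14, p. 402] -/
theorem frame_time_strictMono {γ : ℝ → 𝓢.carrier} {a b : ℝ} (hab : a < b)
    (hγ : 𝓢.metric.IsFutureCausalCurveOn 𝓢.timeOrientation γ (Icc a b)) :
    E4.time (Ξ (γ a)) < E4.time (Ξ (γ b)) := by
  -- the derivative of `t ↦ (Ξ (γ t))⁰`
  have hderiv : ∀ t ∈ Icc a b, ∃ d : ℝ, 0 < d ∧ HasDerivAt (fun t ↦ E4.time (Ξ (γ t))) d t := by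
    intro t ht
    have hγd : MDifferentiableAt 𝓘(ℝ, ℝ) (𝓡 4) γ t := (hγ t ht).1
    have hΞd : MDifferentiableAt (𝓡 4) 𝓘(ℝ, E4) Ξ (γ t) := hΞ.mdifferentiableAt (by simp)
    have hcomp : MDifferentiableAt 𝓘(ℝ, ℝ) 𝓘(ℝ, E4) (Ξ ∘ γ) t := hΞd.comp t hγd
    set w : E4 := mfderiv (𝓡 4) 𝓘(ℝ, E4) Ξ (γ t) (velocity (𝓡 4) γ t) with hw
    have hvel : velocity 𝓘(ℝ, E4) (Ξ ∘ γ) t = w := by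
      simp only [velocity, hw]
      rw [mfderiv_comp t hΞd hγd]
      rfl
    have hd1 : HasDerivAt (Ξ ∘ γ) w t := by
      have h1 : DifferentiableAt ℝ (Ξ ∘ γ) t := mdifferentiableAt_iff_differentiableAt.mp hcomp
      have h3 : deriv (Ξ ∘ γ) t = w := by
        rw [← hvel]
        simp only [velocity, mfderiv_eq_fderiv]
        rfl
      exact h3 ▸ h1.hasDerivAt
    have hd2 : HasDerivAt (fun t ↦ E4.time (Ξ (γ t))) (w 0) t :=
      (EuclideanSpace.proj (0 : Fin 4) : E4 →L[ℝ] ℝ).hasFDerivAt.comp_hasDerivAt t hd1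
    exact ⟨w 0, frame_time_mfderiv_pos 𝓢 Θ Ξ hΘ hΞ hΘΞ hpinΘ hfutΘ (γ t) _ (hγ t ht).2, hd2⟩
  have hcts : ContinuousOn (fun t ↦ E4.time (Ξ (γ t))) (Icc a b) := fun s hs ↦
    (hderiv s hs).choose_spec.2.continuousAt.continuousWithinAt
  have hpos : ∀ s ∈ interior (Icc a b), 0 < deriv (fun t ↦ E4.time (Ξ (γ t))) s := by
    intro s hs
    rw [interior_Icc] at hs
    obtain ⟨d, hdpos, hds⟩ := hderiv s (Ioo_subset_Icc_self hs)
    rwa [hds.deriv]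
  exact strictMonoOn_of_deriv_pos (convex_Icc a b) hcts hpos (left_mem_Icc.2 hab.le)
    (right_mem_Icc.2 hab.le) hab

include hΘ hΞ hΘΞ hpinΘ hfutΘ in
/-- **The floor propagates from the data to its causal future**: if the frame time is `≥ 0` on `S` then it
is `≥ 0` on `J⁺(S)`. [cite: ONeillSemiRiemannian1983, Ch. 14, p. 402] -/
theorem frame_time_nonneg_of_mem_causalFuture (S : Set 𝓢.carrier) (hS : ∀ p ∈ S, 0 ≤ E4.time (Ξ p))
    (a : 𝓢.carrier) (ha : a ∈ 𝓢.metric.causalFuture 𝓢.timeOrientation S) : 0 ≤ E4.time (Ξ a) := by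
  rcases ha with ha | ⟨p, hp, γ, u, v, huv, hγ, hγu, hγv⟩
  · exact hS a ha
  · have h := frame_time_strictMono 𝓢 Θ Ξ hΘ hΞ hΘΞ hpinΘ hfutΘ huv hγ
    rw [hγu, hγv] at h
    exact (hS p hp).trans h.le

end Frame

/-! ### The floor on the data hypersurface only -/

/-- **Construction hypothesis (rough framed axis form, floor on the data)**: as
`RoughFramedAxisPulsesDevelopmentExists` (p162967) but with the floor clause imposed on the data hypersurface
only, `(Ξ (ι p))⁰ ≥ 0` — the frame time being a time function, this is equivalent
(`roughFramedAxisPulsesDevelopmentExists_of_data`). Not constructible in the tree (no maximal development of a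
non-flat admissible datum). Construction hypothesis of a negative lemma, not a published fact (no citation tag). -/
def RoughFramedAxisPulsesDataDevelopmentExists : Prop :=
  ∃ (X : Type) (_ : TopologicalSpace X) (_ : ChartedSpace E3 X) (_ : IsManifold (𝓡 3) ∞ X)
    (_ : T2Space X) (_ : SecondCountableTopology X) (_ : ConnectedSpace X)
    (D : InitialDataSet (𝓡 3) X) (_ : D ∈ admissibleVacuumData X)
    (_ : ¬ ∃ (e : AFEnd X) (M : ℝ), e.IsSoleEnd ∧ e.IsStronglyAsymptoticallyFlatCK D M)
    (𝒟 : VacuumCauchyDevelopment D)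
    (_ : 𝒟.IsMaximal) (_ : HasCompleteNullInfinity 𝒟.toCauchyDevelopment)
    (_ : 𝒟.toCauchyDevelopment.HasVanishingFinalBondiMass)
    (Θ : Minkowski.background.domain → 𝒟.carrier) (Ξ : 𝒟.carrier → E4) (δ : ENNReal),
    ContMDiff 𝓘(ℝ, E4) (𝓡 4) ∞ Θ ∧ ContMDiff (𝓡 4) 𝓘(ℝ, E4) ∞ Ξ ∧
    (∀ p, Θ ⟨Ξ p, Opens.mem_top _⟩ = p) ∧
    (∀ x, ‖𝒟.toSpacetime.deviation Minkowski.background Θ x‖ < 1 / 4) ∧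
    (∀ x, 𝒟.timeOrientation.IsFutureDirected (mfderiv 𝓘(ℝ, E4) (𝓡 4) Θ x (E4.basisVector 0))) ∧
    (∀ p : X, 0 ≤ E4.time (Ξ (𝒟.embed p))) ∧
    0 < δ ∧
    (∀ [𝒟.metric.HasLeviCivita], ∀ s : ℝ, 0 ≤ s →
      ∃ (p : X) (γ : ℝ → 𝒟.carrier) (dom : Set ℝ) (t : ℝ),
        𝒟.metric.IsNormalisedNullRayFrom 𝒟.timeOrientation 𝒟.embed 𝒟.normal p γ dom ∧
          ¬ BddAbove dom ∧ t ∈ dom ∧ 0 ≤ t ∧ γ t = Θ ⟨s • E4.basisVector 0, trivial⟩) ∧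
    (∀ s₀ : ℝ, ∃ s : ℝ, s₀ < s ∧
      ∀ (U : Opens E4) (Φ : (Minkowski.backgroundOn U).domain → 𝒟.carrier)
        (V : Set (Minkowski.backgroundOn U).domain) (x : (Minkowski.backgroundOn U).domain),
        IsOpen V → x ∈ V → ContMDiff 𝓘(ℝ, E4) (𝓡 4) ∞ Φ → IsOpenEmbedding (V.restrict Φ) →
        Φ x = Θ ⟨s • E4.basisVector 0, trivial⟩ →
        δ ≤ supCkENorm {(x : E4)} 2 (𝒟.toSpacetime.deviationExtend (Minkowski.backgroundOn U) Φ))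

/-- **Floor on the data suffices**: `RoughFramedAxisPulsesDataDevelopmentExists → RoughFramedAxisPulsesDevelopmentExists`
(`frame_time_nonneg_of_mem_causalFuture` on `S = range ι`). [folklore] -/
theorem roughFramedAxisPulsesDevelopmentExists_of_data (H : RoughFramedAxisPulsesDataDevelopmentExists) :
    RoughFramedAxisPulsesDevelopmentExists := by
  obtain ⟨X, _, _, _, _, _, _, D, hD, hrough, 𝒟, hmax, hcni, hdrain, Θ, Ξ, δ, hΘ, hΞ, hΘΞ, hpinΘ, hfutΘ,
    hdata, hrest⟩ := H
  refine ⟨X, inferInstance, inferInstance, inferInstance, inferInstance, inferInstance, inferInstance, D, hD,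
    hrough, 𝒟, hmax, hcni, hdrain, Θ, Ξ, δ, hΘ, hΞ, hΘΞ, hpinΘ, hfutΘ, ?_, hrest⟩
  refine frame_time_nonneg_of_mem_causalFuture 𝒟.toSpacetime Θ Ξ hΘ hΞ hΘΞ hpinΘ hfutΘ _ ?_
  rintro _ ⟨p, rfl⟩
  exact hdata p

/-- **Negative lemma modulo `RoughFramedAxisPulsesDataDevelopmentExists`**: the crux as filed fails.
[folklore] -/
theorem DrainImpliesDisperse_false_of_roughFramedAxisPulsesDataDevelopmentExists
    (H : RoughFramedAxisPulsesDataDevelopmentExists) : ¬ DrainImpliesDisperse :=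
  DrainImpliesDisperse_false_of_roughFramedAxisPulsesDevelopmentExists
    (roughFramedAxisPulsesDevelopmentExists_of_data H)

end Summit.FinalStateConjecture.FinalStateConjecture.Theorems.DrainImpliesDisperse.Negative

end
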